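import Mathlib
import Literature.Probability.RandomPlanarGeometry.LoopConfigurations
import Literature.Probability.RandomPlanarGeometry.UnbasedLoopMeasurable
import Literature.Probability.RandomPlanarGeometry.LoopWinding
import Literature.Probability.RandomPlanarGeometry.CLE
import HarnessLib

/-!
# Stub R6 · `Transfer`: the simple-loop reconstruction lemma

Crux `Summit.CriticalPhenomena.CardyFormulaZ2.Theses.CardyMagicRigidity.NestingRigidity`
(stmt-CriticalPhenomena-4835), line `ring-cloud-tomography`, registered stub `stub_transfer : Transfer`
(`Transfer := NestingStatisticsAgree → LoopLimitZ2EqT`, `Theorems/CardyMagicRigidityDefs.lean`).  Step (ii)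
of the intended proof of R6 (`…TransferReduction` p112841, `…TransferReconstruction` p114726) reconstructs a
limit configuration from the rational discs its loops surround; across two configurations this needs a
support property under which an unbased loop is determined, UP TO TIME REVERSAL, by its trace (equivalently,
with `Regular.boundary`, by its winding interior).  The predicate `Regular` is not enough
(`exists_regular_patternCount_eq_not_isClose`, `…RegularNotRigid` p120899: figure-eights `C₋⁺C₊⁺` versus
`C₋⁺C₊⁻`).  This file proves the first brick of any repaired step (ii), the pure-topology statement for
SIMPLE loops (closed curves injective on `[0, 1)`, the tree's `Curve.IsSimpleLoop` of
`Literature/…/CLE.lean`), in a general metric space `E`: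

**two simple loops with the same trace define the same unbased loop up to reversal** — in DKKMO's
distance `d` (`UnbasedLoop.udist`, arXiv:2012.11672v2 eq. (1): infimum over ALL one-to-one
parametrisations of the two loops by the circle) they are at distance `0`, hence equal or reversed
(`UnbasedLoop.udist_eq_zero_iff`).

## Proof

Move the base point of `β` onto `α 0` (`Curve.shift`; `Curve.loopDist` is shift-invariant and a shift of a
simple loop is simple, `isSimpleLoop_shift`).  For two simple loops with the same trace and the same base
point, the **transition map** `t ↦` (the unique `s ∈ (0,1)` with `β s = α t`) is a bijection of `(0, 1)`
(`injOn_transition`, `surjOn_transition`) which is CONTINUOUS (`continuousOn_transition`: for closed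
`T ⊆ [0,1]` the image `β '' T` is compact, and on `(0,1)` the preimage of `T` is `α ⁻¹' (β '' T)` by
uniqueness), hence strictly monotone or antitone (Mathlib's `ContinuousOn.strictMonoOn_of_injOn_Ioo`:
a continuous injective map of an interval).  An increasing bijection of `(0, 1)` extends by `0 ↦ 0`,
`1 ↦ 1` to an increasing reparametrisation `φ : I ≃o I` (`exists_orderIso_eqOn`) with `β ∘ φ = α`; a
decreasing one gives `β.reverse ∘ φ = α` (`exists_reparam_eq_or_of_apply_zero_eq`).  So the based distance
`dist α β` or `dist α β.reverse` vanishes, hence `loopDist α β = 0 ∨ loopDist α β.reverse = 0`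
(`loopDist_eq_zero_or_loopDist_reverse_eq_zero`) and `d = min = 0` (`udist_unroot_eq_zero`,
`udist_eq_zero_of_range_eq`, `eq_or_eq_reverse_of_range_eq`; plane form with winding interiors
`eq_or_eq_reverse_of_setOf_wind_ne_zero_eq`; registered anchor `simpleLoop_udist_eq_zero_of_range_eq`).

No circle lifts are needed: cutting both circles at the common base point reduces the classification of
circle homeomorphisms (orientation-preserving / -reversing) to monotonicity on the open interval.
References: M. Aizenman, A. Burchard, Duke Math. J. 99 (1999), §2.1 (curves modulo monotone
reparametrisation); DKKMO, arXiv:2012.11672v2, §1.2, eq. (1) (the distance `d`); S. Sheffield, W. Werner,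
Ann. of Math. 176 (2012), §2.1 (simple loops).
-/

noncomputable section

open Set Filter Topology Function
open scoped unitInterval

namespace Summit.CriticalPhenomena.CardyFormulaZ2.Cruxes.NestingRigidity.RingCloudTomography

open Literature.Probability.RandomPlanarGeometry

namespace SimpleLoop

variable {E : Type*} [MetricSpace E]

/-- Trichotomy of a time of `[0, 1]`: an end point or an interior time. -/
theorem eq_zero_or_eq_one_or_mem_Ioo (t : I) : t = 0 ∨ t = 1 ∨ t ∈ Ioo (0 : I) 1 := by
  by_cases h0 : t = 0; · exact Or.inl h0
  by_cases h1 : t = 1; · exact Or.inr (Or.inl h1)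
  exact Or.inr (Or.inr ⟨unitInterval.pos_iff_ne_zero.2 h0, unitInterval.lt_one_iff_ne_one.2 h1⟩)

/-- A simple loop does not return to its base point before time `1`. -/
theorem apply_ne_apply_zero {γ : Curve E} (hγ : γ.IsSimpleLoop) {t : I} (ht : t ∈ Ioo (0 : I) 1) :
    γ t ≠ γ 0 := by
  intro h
  have : t = 0 := hγ.2 (mem_Iio.2 ht.2) (mem_Iio.2 zero_lt_one) h
  exact ht.1.ne' this

/-- A simple loop is injective on the open parameter interval. -/
theorem eq_of_apply_eq {γ : Curve E} (hγ : γ.IsSimpleLoop) {s t : I} (hs : s ∈ Ioo (0 : I) 1)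
    (ht : t ∈ Ioo (0 : I) 1) (h : γ s = γ t) : s = t :=
  hγ.2 (mem_Iio.2 hs.2) (mem_Iio.2 ht.2) h

section Based

variable {α β : Curve E}

/-- Two simple loops with the same base point: a time of `β` at which `β` takes an interior value
of `α` is an interior time. -/
theorem mem_Ioo_of_apply_eq (hα : α.IsSimpleLoop) (hβ : β.IsSimpleLoop) (h0 : α 0 = β 0) {t c : I}
    (ht : t ∈ Ioo (0 : I) 1) (hc : β c = α t) : c ∈ Ioo (0 : I) 1 := by
  refine ⟨unitInterval.pos_iff_ne_zero.2 ?_, unitInterval.lt_one_iff_ne_one.2 ?_⟩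
  · rintro rfl
    exact apply_ne_apply_zero hα ht (hc.symm.trans h0.symm)
  · rintro rfl
    have h1 : β 1 = β 0 := hβ.isLoop.symm
    exact apply_ne_apply_zero hα ht (hc.symm.trans (h1.trans h0.symm))

/-- For simple loops with the same trace and base point, every interior value of `α` is an interior
value of `β`. -/
theorem exists_mem_Ioo_apply_eq (hα : α.IsSimpleLoop) (hβ : β.IsSimpleLoop) (h : α.range = β.range)
    (h0 : α 0 = β 0) {t : I} (ht : t ∈ Ioo (0 : I) 1) : ∃ s ∈ Ioo (0 : I) 1, β s = α t := by
  have hmem : α t ∈ β.range := h ▸ Curve.mem_range.2 ⟨t, rfl⟩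
  obtain ⟨s, hs⟩ := Curve.mem_range.1 hmem
  exact ⟨s, mem_Ioo_of_apply_eq hα hβ h0 ht hs, hs⟩

/-- The **transition map** `invFunOn β (Ioo 0 1) ∘ α` between two parametrisations (`t ↦` some time
`s ∈ (0, 1)` with `β s = α t`, Mathlib's `Function.invFunOn`; junk where there is none) takes interior
times to interior times. -/
theorem transition_mem (hα : α.IsSimpleLoop) (hβ : β.IsSimpleLoop) (h : α.range = β.range)
    (h0 : α 0 = β 0) {t : I} (ht : t ∈ Ioo (0 : I) 1) : (invFunOn β (Ioo 0 1) ∘ α) t ∈ Ioo (0 : I) 1 :=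
  Function.invFunOn_mem (exists_mem_Ioo_apply_eq hα hβ h h0 ht)

/-- The defining equation of the transition map: `β ((invFunOn β (Ioo 0 1) ∘ α) t) = α t`. -/
theorem apply_transition (hα : α.IsSimpleLoop) (hβ : β.IsSimpleLoop) (h : α.range = β.range)
    (h0 : α 0 = β 0) {t : I} (ht : t ∈ Ioo (0 : I) 1) : β ((invFunOn β (Ioo 0 1) ∘ α) t) = α t :=
  Function.invFunOn_eq (exists_mem_Ioo_apply_eq hα hβ h h0 ht)

/-- Uniqueness: the transition time is the only solution of `β c = α t`. -/
theorem eq_transition (hα : α.IsSimpleLoop) (hβ : β.IsSimpleLoop) (h : α.range = β.range)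
    (h0 : α 0 = β 0) {t c : I} (ht : t ∈ Ioo (0 : I) 1) (hc : β c = α t) : c = (invFunOn β (Ioo 0 1) ∘ α) t :=
  eq_of_apply_eq hβ (mem_Ioo_of_apply_eq hα hβ h0 ht hc) (transition_mem hα hβ h h0 ht)
    (hc.trans (apply_transition hα hβ h h0 ht).symm)

/-- The transition map is injective on the open interval. -/
theorem injOn_transition (hα : α.IsSimpleLoop) (hβ : β.IsSimpleLoop) (h : α.range = β.range)
    (h0 : α 0 = β 0) : InjOn (invFunOn β (Ioo 0 1) ∘ α) (Ioo 0 1) := by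
  intro s hs t ht hst
  apply eq_of_apply_eq hα hs ht
  rw [← apply_transition hα hβ h h0 hs, ← apply_transition hα hβ h h0 ht, hst]

/-- The transition map is onto the open interval. -/
theorem surjOn_transition (hα : α.IsSimpleLoop) (hβ : β.IsSimpleLoop) (h : α.range = β.range)
    (h0 : α 0 = β 0) : SurjOn (invFunOn β (Ioo 0 1) ∘ α) (Ioo 0 1) (Ioo 0 1) := by
  intro s hs
  obtain ⟨t, ht, hts⟩ := exists_mem_Ioo_apply_eq hβ hα h.symm h0.symm hs
  exact ⟨t, ht, (eq_transition hα hβ h h0 ht hts.symm).symm⟩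

/-- **The transition map is continuous on the open interval.**  A closed `T ⊆ [0, 1]` has compact,
hence closed, image `β '' T`, and on `(0, 1)` the preimage of `T` under the transition map is the
closed set `α ⁻¹' (β '' T)` (uniqueness of the transition time). -/
theorem continuousOn_transition (hα : α.IsSimpleLoop) (hβ : β.IsSimpleLoop) (h : α.range = β.range)
    (h0 : α 0 = β 0) : ContinuousOn (invFunOn β (Ioo 0 1) ∘ α) (Ioo 0 1) := by
  rw [continuousOn_iff_isClosed]
  intro T hT
  refine ⟨α ⁻¹' (β '' T), ((hT.isCompact.image β.continuous).isClosed).preimage α.continuous, ?_⟩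
  ext t
  simp only [mem_inter_iff, mem_preimage, mem_image]
  constructor
  · rintro ⟨htT, ht⟩
    exact ⟨⟨(invFunOn β (Ioo 0 1) ∘ α) t, htT, apply_transition hα hβ h h0 ht⟩, ht⟩
  · rintro ⟨⟨c, hcT, hc⟩, ht⟩
    exact ⟨(eq_transition hα hβ h h0 ht hc) ▸ hcT, ht⟩

/-- The transition map is strictly monotone or strictly antitone on the open interval
(a continuous injective map of an interval). -/
theorem strictMonoOn_or_strictAntiOn_transition (hα : α.IsSimpleLoop) (hβ : β.IsSimpleLoop)
    (h : α.range = β.range) (h0 : α 0 = β 0) :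
    StrictMonoOn (invFunOn β (Ioo 0 1) ∘ α) (Ioo 0 1) ∨ StrictAntiOn (invFunOn β (Ioo 0 1) ∘ α) (Ioo 0 1) :=
  (continuousOn_transition hα hβ h h0).strictMonoOn_of_injOn_Ioo zero_lt_one
    (injOn_transition hα hβ h h0)

/-- **Extension of a monotone bijection of the open interval to an increasing reparametrisation of
`[0, 1]`.**  A strictly increasing map of `(0, 1)` onto itself extends (by `0 ↦ 0`, `1 ↦ 1`) to an
order automorphism of `[0, 1]`. -/
theorem exists_orderIso_eqOn {g : I → I} (hg : StrictMonoOn g (Ioo 0 1))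
    (hmaps : MapsTo g (Ioo 0 1) (Ioo 0 1)) (hsurj : SurjOn g (Ioo 0 1) (Ioo 0 1)) :
    ∃ φ : I ≃o I, EqOn φ g (Ioo 0 1) := by
  classical
  let f : I → I := fun t ↦ if t ∈ Ioo (0 : I) 1 then g t else t
  have hf_of_mem : ∀ {t : I}, t ∈ Ioo (0 : I) 1 → f t = g t := fun {t} ht ↦ if_pos ht
  have hf_of_not_mem : ∀ {t : I}, t ∉ Ioo (0 : I) 1 → f t = t := fun {t} ht ↦ if_neg ht
  have hmono : StrictMono f := by
    intro a b hab
    by_cases ha : a ∈ Ioo (0 : I) 1 <;> by_cases hb : b ∈ Ioo (0 : I) 1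
    · rw [hf_of_mem ha, hf_of_mem hb]
      exact hg ha hb hab
    · -- `b = 1`
      have hb1 : b = 1 := by
        by_contra hb1
        exact hb ⟨ha.1.trans hab, unitInterval.lt_one_iff_ne_one.2 hb1⟩
      rw [hf_of_mem ha, hf_of_not_mem hb, hb1]
      exact (hmaps ha).2
    · -- `a = 0`
      have ha0 : a = 0 := by
        by_contra ha0
        exact ha ⟨unitInterval.pos_iff_ne_zero.2 ha0, hab.trans hb.2⟩
      rw [hf_of_not_mem ha, hf_of_mem hb, ha0]
      exact (hmaps hb).1
    · rw [hf_of_not_mem ha, hf_of_not_mem hb]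
      exact hab
  have hsurjf : Function.Surjective f := by
    intro y
    by_cases hy : y ∈ Ioo (0 : I) 1
    · obtain ⟨x, hx, rfl⟩ := hsurj hy
      exact ⟨x, hf_of_mem hx⟩
    · exact ⟨y, hf_of_not_mem hy⟩
  refine ⟨hmono.orderIsoOfSurjective f hsurjf, fun t ht ↦ ?_⟩
  change f t = g t
  exact hf_of_mem ht

/-- Gluing at the end points: if `γ ∘ φ = α` on `(0, 1)` and the two curves have the same end
points then `γ.reparam φ = α`. -/
theorem reparam_eq_of_eqOn {α γ : Curve E} (φ : I ≃o I) (h0 : γ 0 = α 0) (h1 : γ 1 = α 1)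
    (heq : ∀ t ∈ Ioo (0 : I) 1, γ (φ t) = α t) : γ.reparam φ = α := by
  apply DFunLike.coe_injective
  funext t
  rw [Curve.reparam_apply]
  rcases eq_zero_or_eq_one_or_mem_Ioo t with rfl | rfl | ht
  · rw [show φ 0 = 0 from OrderIso.map_bot φ, h0]
  · rw [show φ 1 = 1 from OrderIso.map_top φ, h1]
  · exact heq t ht

/-- **Based reconstruction.**  Two simple loops with the same trace AND the same base point differ
by an increasing reparametrisation of `[0, 1]`, after possibly reversing time: the transition map
is a monotone bijection of `(0, 1)` (`strictMonoOn_or_strictAntiOn_transition`); if increasing it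
extends to `φ : I ≃o I` with `β ∘ φ = α`, if decreasing then `t ↦ 1 - transition t` does, with
`β.reverse ∘ φ = α`. -/
theorem exists_reparam_eq_or_of_apply_zero_eq (hα : α.IsSimpleLoop) (hβ : β.IsSimpleLoop)
    (h : α.range = β.range) (h0 : α 0 = β 0) :
    (∃ φ : I ≃o I, β.reparam φ = α) ∨ (∃ φ : I ≃o I, β.reverse.reparam φ = α) := by
  have hα1 : α 1 = α 0 := hα.isLoop.symm
  have hβ1 : β 1 = β 0 := hβ.isLoop.symm
  have hmaps : MapsTo (invFunOn β (Ioo 0 1) ∘ α) (Ioo 0 1) (Ioo 0 1) := fun t ht ↦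
    transition_mem hα hβ h h0 ht
  rcases strictMonoOn_or_strictAntiOn_transition hα hβ h h0 with hmono | hanti
  · obtain ⟨φ, hφ⟩ := exists_orderIso_eqOn hmono hmaps (surjOn_transition hα hβ h h0)
    refine Or.inl ⟨φ, reparam_eq_of_eqOn φ h0.symm (by rw [hα1, hβ1, h0]) fun t ht ↦ ?_⟩
    rw [hφ ht, apply_transition hα hβ h h0 ht]
  · -- the reversed transition map `σ ∘ transition` is increasing and onto `(0, 1)`
    set g : I → I := fun t ↦ σ ((invFunOn β (Ioo 0 1) ∘ α) t) with hg
    have hσ : ∀ {x : I}, x ∈ Ioo (0 : I) 1 → σ x ∈ Ioo (0 : I) 1 := fun {x} hx ↦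
      ⟨unitInterval.lt_symm_comm.2 (by rw [unitInterval.symm_zero]; exact hx.2),
        unitInterval.symm_lt_comm.2 (by rw [unitInterval.symm_one]; exact hx.1)⟩
    have hgmono : StrictMonoOn g (Ioo 0 1) := fun a ha b hb hab ↦
      unitInterval.symm_lt_symm.2 (hanti ha hb hab)
    have hgmaps : MapsTo g (Ioo 0 1) (Ioo 0 1) := fun t ht ↦ hσ (hmaps ht)
    have hgsurj : SurjOn g (Ioo 0 1) (Ioo 0 1) := by
      intro y hy
      obtain ⟨x, hx, hxy⟩ := surjOn_transition hα hβ h h0 (hσ hy)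
      refine ⟨x, hx, ?_⟩
      change σ ((invFunOn β (Ioo 0 1) ∘ α) x) = y
      rw [hxy, unitInterval.symm_symm]
    obtain ⟨φ, hφ⟩ := exists_orderIso_eqOn hgmono hgmaps hgsurj
    refine Or.inr ⟨φ, reparam_eq_of_eqOn φ ?_ ?_ fun t ht ↦ ?_⟩
    · rw [Curve.reverse_apply, unitInterval.symm_zero, hβ1, h0]
    · rw [Curve.reverse_apply, unitInterval.symm_one, hα1, h0]
    · rw [Curve.reverse_apply, hφ ht, hg]
      simp only [unitInterval.symm_symm]
      exact apply_transition hα hβ h h0 ht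

/-- **Based reconstruction, metric form**: two simple loops with the same trace and the same base
point are at based (Camia–Newman) reparametrisation distance `0` from each other or from the time
reversal of each other. -/
theorem dist_eq_zero_or_dist_reverse_eq_zero (hα : α.IsSimpleLoop) (hβ : β.IsSimpleLoop)
    (h : α.range = β.range) (h0 : α 0 = β 0) : dist α β = 0 ∨ dist α β.reverse = 0 := by
  rcases exists_reparam_eq_or_of_apply_zero_eq hα hβ h h0 with ⟨φ, hφ⟩ | ⟨φ, hφ⟩
  · exact Or.inl (by rw [← hφ]; exact Curve.dist_self_reparam β φ)
  · exact Or.inr (by rw [← hφ]; exact Curve.dist_self_reparam β.reverse φ)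

end Based

/-! ### Unbased loops: change of base point -/

/-- **A change of base point preserves simplicity.** -/
theorem isSimpleLoop_shift {β : Curve E} (hβ : β.IsSimpleLoop) (b : ℝ) : (β.shift b).IsSimpleLoop := by
  refine ⟨Curve.isLoop_shift hβ.isLoop b, fun s hs t ht hst ↦ ?_⟩
  have hs1 : (s : ℝ) < 1 := hs
  have ht1 : (t : ℝ) < 1 := ht
  rw [Curve.shift_apply hβ.isLoop, Curve.shift_apply hβ.isLoop, Curve.loopMap_coe_eq,
    Curve.loopMap_coe_eq] at hst
  have hlt : ∀ z : ℝ,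
      (⟨Int.fract z, Int.fract_nonneg z, (Int.fract_lt_one z).le⟩ : I) ∈ Iio (1 : I) :=
    fun z ↦ show Int.fract z < (1 : ℝ) from Int.fract_lt_one z
  have hfr : Int.fract ((s : ℝ) + b) = Int.fract ((t : ℝ) + b) :=
    congrArg Subtype.val (hβ.2 (hlt _) (hlt _) hst)
  obtain ⟨z, hz⟩ := Int.fract_eq_fract.1 hfr
  have hz' : (s : ℝ) - t = z := by rw [← hz]; ring
  have hz0 : z = 0 := by
    have h1 : (z : ℝ) < 1 := by rw [← hz']; linarith [s.2.2, t.2.1]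
    have h2 : (-1 : ℝ) < z := by rw [← hz']; linarith [s.2.1, t.2.2]
    have h1' : z < 1 := by exact_mod_cast h1
    have h2' : -1 < z := by exact_mod_cast h2
    omega
  rw [hz0, Int.cast_zero, sub_eq_zero] at hz'
  exact Subtype.ext hz'

/-- **Unbased reconstruction (curve level).**  Two simple loops with the same trace are at unbased
oriented reparametrisation distance `0` (`Curve.loopDist`, DKKMO's `d` restricted to
orientation-preserving parametrisations) from each other or from the time reversal of each other:
move the base point of `β` to `α 0` (`Curve.shift`; `loopDist` is shift-invariant) and apply the
based statement. -/
theorem loopDist_eq_zero_or_loopDist_reverse_eq_zero {α β : Curve E} (hα : α.IsSimpleLoop)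
    (hβ : β.IsSimpleLoop) (h : α.range = β.range) :
    Curve.loopDist α β = 0 ∨ Curve.loopDist α β.reverse = 0 := by
  -- a time `b < 1` with `β b = α 0`
  obtain ⟨b, hb1, hb⟩ : ∃ b : I, (b : ℝ) < 1 ∧ β b = α 0 := by
    have hmem : α 0 ∈ β.range := h ▸ Curve.mem_range.2 ⟨0, rfl⟩
    obtain ⟨b₀, hb₀⟩ := Curve.mem_range.1 hmem
    rcases eq_or_ne b₀ 1 with rfl | hne
    · exact ⟨0, by norm_num, hβ.isLoop.trans hb₀⟩
    · exact ⟨b₀, unitInterval.lt_one_iff_ne_one.2 hne, hb₀⟩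
  set β' : Curve E := β.shift b with hβ'
  have hβ's : β'.IsSimpleLoop := isSimpleLoop_shift hβ b
  have hr : α.range = β'.range := by rw [hβ', Curve.range_shift]; exact h
  have h0 : α 0 = β' 0 := by
    rw [hβ', Curve.shift_apply hβ.isLoop, Set.Icc.coe_zero, zero_add,
      Curve.loopMap_coe ⟨b.2.1, hb1⟩]
    exact hb.symm
  rcases dist_eq_zero_or_dist_reverse_eq_zero hα hβ's hr h0 with hd | hd
  · left
    rw [← Curve.loopDist_shift_right α β b]
    exact le_antisymm ((Curve.loopDist_le_reparamDist α β').trans_eq hd) (Curve.loopDist_nonneg _ _)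
  · right
    rw [← Curve.loopDist_shift_right α β.reverse (-(b : ℝ)), ← Curve.reverse_shift]
    exact le_antisymm ((Curve.loopDist_le_reparamDist α β'.reverse).trans_eq hd)
      (Curve.loopDist_nonneg _ _)

/-! ### Unbased loops: DKKMO's `d` and equality up to reversal -/

/-- The unbased distance of unrooted loop curves is their `loopDist`. -/
theorem dist_unroot_unroot (α β : {γ : Curve E // γ.IsLoop}) :
    dist (Curve.unroot α) (Curve.unroot β) = Curve.loopDist α.1 β.1 := rfl

/-- Reversal commutes with unrooting. -/
theorem reverse_unroot (β : {γ : Curve E // γ.IsLoop}) :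
    (Curve.unroot β).reverse = Curve.unroot ⟨β.1.reverse, (Curve.isLoop_reverse_iff β.1).2 β.2⟩ := rfl

/-- **Simple-loop reconstruction, `d`-form.**  The unbased loops of two simple loop curves with the
same trace are at DKKMO distance `d = 0` (`UnbasedLoop.udist`, arXiv:2012.11672v2 eq. (1): infimum
over ALL one-to-one parametrisations by the circle). -/
theorem udist_unroot_eq_zero {α β : Curve E} (hα : α.IsSimpleLoop) (hβ : β.IsSimpleLoop)
    (h : α.range = β.range) :
    (Curve.unroot ⟨α, hα.isLoop⟩).udist (Curve.unroot ⟨β, hβ.isLoop⟩) = 0 := by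
  refine le_antisymm ?_ (UnbasedLoop.udist_nonneg _ _)
  rcases loopDist_eq_zero_or_loopDist_reverse_eq_zero hα hβ h with hd | hd
  · exact (UnbasedLoop.udist_le_dist _ _).trans_eq hd
  · exact (UnbasedLoop.udist_le_dist_reverse _ _).trans_eq hd

/-- **Simple-loop reconstruction.**  Two simple loop curves with the same trace define the same
unbased loop up to time reversal. -/
theorem unroot_eq_or_eq_reverse {α β : Curve E} (hα : α.IsSimpleLoop) (hβ : β.IsSimpleLoop)
    (h : α.range = β.range) :
    Curve.unroot ⟨β, hβ.isLoop⟩ = Curve.unroot ⟨α, hα.isLoop⟩ ∨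
      Curve.unroot ⟨β, hβ.isLoop⟩ = (Curve.unroot ⟨α, hα.isLoop⟩).reverse :=
  UnbasedLoop.udist_eq_zero_iff.1 (udist_unroot_eq_zero hα hβ h)

/-- **Simple unbased loops are determined by their trace up to reversal** (`d`-form): if `u` and
`v` admit based representatives injective on `[0, 1)` and have the same trace then `d(u, v) = 0`. -/
theorem udist_eq_zero_of_range_eq {u v : UnbasedLoop E}
    (hu : ∃ γ : {γ : Curve E // γ.IsLoop}, InjOn γ.1 (Iio 1) ∧ Curve.unroot γ = u)
    (hv : ∃ γ : {γ : Curve E // γ.IsLoop}, InjOn γ.1 (Iio 1) ∧ Curve.unroot γ = v)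
    (h : u.range = v.range) : u.udist v = 0 := by
  obtain ⟨⟨α, hαl⟩, hαi, rfl⟩ := hu
  obtain ⟨⟨β, hβl⟩, hβi, rfl⟩ := hv
  exact udist_unroot_eq_zero ⟨hαl, hαi⟩ ⟨hβl, hβi⟩ h

/-- **Simple unbased loops are determined by their trace up to reversal.** -/
theorem eq_or_eq_reverse_of_range_eq {u v : UnbasedLoop E}
    (hu : ∃ γ : {γ : Curve E // γ.IsLoop}, InjOn γ.1 (Iio 1) ∧ Curve.unroot γ = u)
    (hv : ∃ γ : {γ : Curve E // γ.IsLoop}, InjOn γ.1 (Iio 1) ∧ Curve.unroot γ = v)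
    (h : u.range = v.range) : v = u ∨ v = u.reverse :=
  UnbasedLoop.udist_eq_zero_iff.1 (udist_eq_zero_of_range_eq hu hv h)

/-! ### Plane loops: traces, winding interiors, and the registered anchor -/

/-- **Cross-configuration separation for simple plane loops.**  Two simple unbased loops of the plane
whose traces are the frontiers of their winding interiors (the `Regular.boundary` property) and whose
winding interiors `{z | W(u, z) ≠ 0}` coincide are equal up to time reversal — the cross-configuration
form of `Regular.separating` that step (ii) of R6 needs, for simple loops. -/
theorem eq_or_eq_reverse_of_setOf_wind_ne_zero_eq {u v : UnbasedLoop ℂ}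
    (hu : ∃ γ : {γ : Curve ℂ // γ.IsLoop}, InjOn γ.1 (Iio 1) ∧ Curve.unroot γ = u)
    (hv : ∃ γ : {γ : Curve ℂ // γ.IsLoop}, InjOn γ.1 (Iio 1) ∧ Curve.unroot γ = v)
    (hbu : u.range = frontier {z | u.wind z ≠ 0}) (hbv : v.range = frontier {z | v.wind z ≠ 0})
    (h : {z | u.wind z ≠ 0} = {z | v.wind z ≠ 0}) : v = u ∨ v = u.reverse :=
  eq_or_eq_reverse_of_range_eq hu hv (by rw [hbu, hbv, h])

end SimpleLoop

/-- **Simple-loop reconstruction (registered anchor, plane form).**  Two unbased loops of the plane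
admitting based representatives `γ : [0, 1] → ℂ` (closed, injective on `[0, 1)`; entered as in the line's
skeleton, `UnbasedLoop.mk (BasedLoop.mk (CurveClass.mk γ) _)`, i.e. `Curve.unroot`) with the same trace are
at DKKMO distance `d = 0` (`UnbasedLoop.udist`; hence equal or time reversals of each other,
`UnbasedLoop.udist_eq_zero_iff`). -/
theorem simpleLoop_udist_eq_zero_of_range_eq : ∀ (u v : UnbasedLoop ℂ),
    (∃ (γ : Curve ℂ) (hγ : γ.IsLoop), InjOn γ (Iio 1) ∧
      UnbasedLoop.mk (BasedLoop.mk (CurveClass.mk γ) hγ) = u) →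
    (∃ (γ : Curve ℂ) (hγ : γ.IsLoop), InjOn γ (Iio 1) ∧
      UnbasedLoop.mk (BasedLoop.mk (CurveClass.mk γ) hγ) = v) →
    u.range = v.range → u.udist v = 0 :=
  fun _ _ ⟨α, hα, hαi, hu⟩ ⟨β, hβ, hβi, hv⟩ h ↦
    SimpleLoop.udist_eq_zero_of_range_eq ⟨⟨α, hα⟩, hαi, hu⟩ ⟨⟨β, hβ⟩, hβi, hv⟩ h

end Summit.CriticalPhenomena.CardyFormulaZ2.Cruxes.NestingRigidity.RingCloudTomography

end
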